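import Mathlib.Algebra.MvPolynomial.NoZeroDivisors
import Literature.Computability.AlgebraicComplexity.ST21OrbitHittingSets
import Literature.Computability.AlgebraicComplexity.MS21SigmaPiOrbitsProofs
import Literature.Computability.AlgebraicComplexity.SparseCircuitBounds
import Literature.Computability.AlgebraicComplexity.IMMInVPProofs
import HarnessLib

/-!
# Circuit-complexity bounds for the polynomials of Saha–Thankey formulas (support for Thms 9/10)

Topic `Literature/Computability/AlgebraicComplexity` (cell `val-lit`, row X3-ST21). Theorem-only
support file (no definitions, no named facts) for the EXISTENCE readings of the hitting-set theorems
of C. Saha, B. Thankey, *Hitting sets for orbits of circuit classes and polynomial families*,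
APPROX/RANDOM 2021 (LIPIcs 207:50) [SahaThankey2021], typed in `ST21OrbitHittingSets.lean`
(`sahaThankey2021_thm_9`, `sahaThankey2021_thm_10`: "a hitting set of size `≤ T` exists",
explicitness dropped). Those readings follow from the tree's **non-explicit hitting sets for
polynomials of small circuit size** (`HittingSets.exists_hittingSet`, Heintz–Schnorr 1980 Thm. 4.4,
`HittingSetsExist.lean`) once the members of the class are shown to have small circuit complexity
`complexity` (Bürgisser's `L`, `ArithCircuit.lean`). This file supplies those complexity bounds for
the polynomial `φ.eval` computed by an ST Def. 3 formula `φ : SahaThankey2021.Formula F n`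
(leaves = sparse polynomials, `+` gates with field labels, `×⋏` gates with exponent weights):

* leaves: an `s`-sparse polynomial of degree `d` has `L ≤ s(2d+2)` (the tree's
  `complexity_le_card_support_mul`, `SparseCircuitBounds.lean`; the printed "a degree-`d` `s`-sparse
  polynomial can be computed by a depth-2 circuit of size `sd`", p. 50:3 L15, in the tree's gate count);
  a `b`-variate polynomial of degree `d` has at most `(d+1)^b` monomials (private
  `card_support_le_pow_card_vars`).
* `complexity_eval_le_two_mul_size` — **`L(φ.eval) ≤ 2 · φ.size`** for every formula (ST Def. 3's
  size = weighted edge count + depth-2 sizes of the leaves); `totalDegree_eval_le_size_pow_depth` —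
  `deg φ.eval ≤ φ.size ^ φ.depth`.
* **Occur-once formulas (Thm. 10, no size hypothesis).** `exists_core_of_isOccur_one` /
  `complexity_eval_le_of_isOccur_one`: if every variable occurs in at most one leaf then
  `L(φ.eval) ≤ (w + (D+3)(2 + log₂ D)) · n` whenever `deg φ.eval ≤ D` and every leaf of degree `≤ D`
  has `L ≤ w` — a SEMANTIC induction (the formula may be arbitrarily large): constant-valued subtrees
  are folded, a gate with exactly one non-constant live child computes `t ↦ αt + β` (free) or
  `t ↦ γ·(αt+β)^e`, `e ≥ 2` (charged to the doubling of the degree, at most `log₂ D` times on a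
  root–leaf path), gates with `≥ 2` live children are charged to the additive potential
  `Σ_i φ.occur i ≤ n`; the enabling lemma is that distinct children of a gate of an occur-once
  formula have DISJOINT variable sets (`vars_eval_subset`), so no cancellation occurs and every live
  sub-polynomial has degree `≤ D` (`totalDegree_le_totalDegree_sum_of_disjoint`). Specialisations:
  `complexity_eval_le_of_isOccur_one_of_leavesSparse` (`w = 2s(D+1)`),
  `complexity_eval_le_of_isOccur_one_of_leavesVariate` (`w = 2(D+1)^{b+1}`).
* Orbits: `complexity_affSubst_le`, `complexity_le_of_mem_linOrbit` (`L(f(Ax)) ≤ L(f) + n(2n+1)`,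
  from `complexity_aeval_le`), `totalDegree_le_of_mem_linOrbit`.

HONEST FRAMING: elementary bookkeeping about a 2021 paper's formula model, used to derive the
existence (not the explicit construction) of its hitting sets; `VP ≠ VNP` is NOT proved and nothing
here bears on it.

## References

* [SahaThankey2021] C. Saha, B. Thankey, APPROX/RANDOM 2021, LIPIcs 207:50, Def. 3 (p. 50:3),
  Thms 9, 10 (p. 50:5).
* [Burgisser2000] P. Bürgisser, *Completeness and Reduction in Algebraic Complexity Theory*, §2.1
  (the measure `L`).
-/

noncomputable section

open MvPolynomial

namespace Literature.Computability.AlgebraicComplexity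

namespace SahaThankey2021

variable {F : Type*} [Field F] {n : ℕ}

/-! ### Generic complexity bounds: powers, monomials, sparse and few-variable polynomials -/

section Generic

variable {σ : Type*}

/-- `L(x_i^e) ≤ e`. [cite: Burgisser2000, §2.1] -/
theorem complexity_X_pow_le (i : σ) (e : ℕ) : complexity (X i ^ e : MvPolynomial σ F) ≤ e := by
  classical
  have h := complexity_finset_prod_le (Finset.range e) (fun _ => (X i : MvPolynomial σ F))
  rw [Finset.prod_const, Finset.card_range] at h
  refine h.trans ?_
  rw [Finset.sum_eq_zero fun j _ => complexity_X_holds (k := F) i, zero_add]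

/-- `L(f^e) ≤ L(f) + e` (compute `f` once, then `e` multiplications). [cite: Burgisser2000, §2.1] -/
theorem complexity_pow_le (f : MvPolynomial σ F) (e : ℕ) : complexity (f ^ e) ≤ complexity f + e := by
  have h := complexity_aeval_le (X () ^ e : MvPolynomial Unit F) (fun _ => f)
  rw [map_pow, aeval_X] at h
  refine h.trans ?_
  rw [Fintype.sum_unique, add_comm]
  exact Nat.add_le_add_left (complexity_X_pow_le () e) _

/-- **Few-variable polynomials are sparse**: a polynomial in `b` variables of degree `d` has at most
`(d+1)^b` monomials. [folklore] -/
private theorem card_support_le_pow_card_vars (p : MvPolynomial σ F) :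
    p.support.card ≤ (p.totalDegree + 1) ^ p.vars.card := by
  classical
  let ι : p.support → (p.vars → Fin (p.totalDegree + 1)) := fun m x =>
    ⟨m.1 x.1, Nat.lt_succ_of_le ((monomial_le_degreeOf x.1 m.2).trans (degreeOf_le_totalDegree p x.1))⟩
  have hι : Function.Injective ι := by
    rintro ⟨m, hm⟩ ⟨m', hm'⟩ h
    apply Subtype.ext
    ext x
    by_cases hx : x ∈ p.vars
    · have := congrArg (fun f => (f ⟨x, hx⟩ : ℕ)) h
      simpa [ι] using this
    · have h1 : m x = 0 := by
        by_contra h0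
        exact hx ((mem_vars_iff_mem_support x).mpr ⟨m, hm, Finsupp.mem_support_iff.mpr h0⟩)
      have h2 : m' x = 0 := by
        by_contra h0
        exact hx ((mem_vars_iff_mem_support x).mpr ⟨m', hm', Finsupp.mem_support_iff.mpr h0⟩)
      rw [h1, h2]
  have h := Fintype.card_le_of_injective ι hι
  rwa [Fintype.card_coe, Fintype.card_fun, Fintype.card_coe, Fintype.card_fin] at h

/-- An affine form costs at most `2n + 1`. [cite: Burgisser2000, §2.1] -/
theorem complexity_affineForm_le (a : Fin n → F) (c : F) :
    complexity ((∑ j : Fin n, C (a j) * X j) + C c : MvPolynomial (Fin n) F) ≤ 2 * n + 1 := by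
  refine (complexity_add_le_holds _ _).trans ?_
  rw [complexity_C_holds (k := F) c, add_zero]
  have h := complexity_finset_sum_le (Finset.univ : Finset (Fin n)) (fun j => C (a j) * X j)
  have h2 : ∑ j : Fin n, complexity (C (a j) * X j : MvPolynomial (Fin n) F) ≤ ∑ _j : Fin n, 1 := by
    refine Finset.sum_le_sum fun j _ => (complexity_mul_le_holds _ _).trans ?_
    rw [complexity_C_holds (k := F), complexity_X_holds (k := F)]
  rw [Finset.sum_const, Finset.card_univ, Fintype.card_fin, smul_eq_mul, mul_one] at h2
  rw [Finset.card_univ, Fintype.card_fin] at h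
  omega

end Generic

/-! ### Orbits do not increase complexity by more than the cost of the substitution -/

section Orbits

variable {m : ℕ}

/-- `L(f(Ax+b)) ≤ L(f) + m(2n+1)` (`m` affine forms in `n` variables, then a circuit for `f`).
[cite: Burgisser2000, Rem. 2.7] -/
theorem complexity_affSubst_le (h : m ≤ n) (A : Matrix (Fin n) (Fin n) F) (b : Fin n → F)
    (f : MvPolynomial (Fin m) F) :
    complexity (MS2021.affSubst h A b f) ≤ complexity f + m * (2 * n + 1) := by
  unfold MS2021.affSubst
  refine (complexity_aeval_le f _).trans (Nat.add_le_add_left ?_ _)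
  calc ∑ i : Fin m, complexity ((∑ j : Fin n, C (A (Fin.castLE h i) j) * X j) +
          C (b (Fin.castLE h i)) : MvPolynomial (Fin n) F)
      ≤ ∑ _i : Fin m, (2 * n + 1) := Finset.sum_le_sum fun i _ => complexity_affineForm_le _ _
    _ = m * (2 * n + 1) := by rw [Finset.sum_const, Finset.card_univ, Fintype.card_fin, smul_eq_mul]

/-- Members of the orbit `f^{GL_n(F)}` cost at most `L(f) + n(2n+1)`. [cite: Burgisser2000, Rem. 2.7] -/
theorem complexity_le_of_mem_linOrbit {f : MvPolynomial (Fin m) F} {g : MvPolynomial (Fin n) F}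
    (hg : g ∈ MS2021.linOrbit n f) : complexity g ≤ complexity f + n * (2 * n + 1) := by
  obtain ⟨h, A, -, rfl⟩ := hg
  exact (complexity_affSubst_le h A 0 f).trans
    (Nat.add_le_add_left (Nat.mul_le_mul_right _ h) _)

/-- Members of the orbit `f^{GL_n(F)}` have degree at most `deg f`.
[cite: MediniShpilka2021, §1.1 (orbits)] -/
theorem totalDegree_le_of_mem_linOrbit {f : MvPolynomial (Fin m) F} {g : MvPolynomial (Fin n) F}
    (hg : g ∈ MS2021.linOrbit n f) : g.totalDegree ≤ f.totalDegree := by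
  obtain ⟨h, A, -, rfl⟩ := hg
  exact MS2021.totalDegree_affSubst_le h A 0 f

end Orbits

/-! ### Every formula: `L(φ.eval) ≤ 2 · size`, `deg φ.eval ≤ size ^ depth` -/

section AllFormulas

/-- Every formula has depth at least `1` (a leaf has depth `2`). [cite: SahaThankey2021, Def. 3 (p. 50:3)] -/
theorem one_le_depth (φ : Formula F n) : 1 ≤ φ.depth := by
  cases φ <;> simp [Formula.depth]

/-- **`L(φ.eval) ≤ 2 · φ.size`** for every ST formula: a `+` gate with `k` in-edges costs `k` scalar
multiplications and `k` additions, a `×⋏` gate with weights `e` costs `Σ eᵢ` multiplications (each child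
computed once), a leaf costs at most twice its depth-2 size. [cite: SahaThankey2021, Def. 3 (p. 50:3)] -/
theorem complexity_eval_le_two_mul_size (φ : Formula F n) : complexity φ.eval ≤ 2 * φ.size := by
  classical
  induction φ with
  | leaf p =>
      simp only [Formula.eval, Formula.size]
      calc complexity p ≤ p.support.card * (2 * p.totalDegree + 2) := complexity_le_card_support_mul p
        _ = 2 * (p.support.card * (p.totalDegree + 1)) := by ring
  | add k α g ih =>
      simp only [Formula.eval, Formula.size]
      refine (complexity_finset_sum_le _ _).trans ?_
      rw [Finset.card_univ, Fintype.card_fin]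
      have h1 : ∑ i : Fin k, complexity (α i • (g i).eval) ≤ ∑ i : Fin k, (2 * (g i).size + 1) :=
        Finset.sum_le_sum fun i _ => (complexity_smul_le_holds _ _).trans (by have := ih i; omega)
      calc ∑ i : Fin k, complexity (α i • (g i).eval) + k
          ≤ ∑ i : Fin k, (2 * (g i).size + 1) + k := Nat.add_le_add_right h1 _
        _ = 2 * ∑ i : Fin k, ((g i).size + 1) := by
          rw [Finset.mul_sum, Finset.sum_add_distrib, Finset.sum_const, Finset.card_univ,
            Fintype.card_fin, smul_eq_mul, mul_one]
          simp only [mul_add, mul_one, Finset.sum_add_distrib, Finset.sum_const, Finset.card_univ,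
            Fintype.card_fin, smul_eq_mul]
          ring
  | mulPow k e g ih =>
      simp only [Formula.eval, Formula.size]
      -- drop the factors with exponent `0` (they are `1`)
      rw [← Finset.prod_filter_of_ne (p := fun i => e i ≠ 0)
        (fun i _ hi => by intro h0; exact hi (by rw [h0, pow_zero]))]
      set T := Finset.univ.filter (fun i : Fin k => e i ≠ 0) with hT
      refine (complexity_finset_prod_le _ _).trans ?_
      have h1 : ∑ i ∈ T, complexity ((g i).eval ^ e i) + T.card ≤ ∑ i ∈ T, (2 * (g i).size + 2 * e i) := by
        rw [Finset.card_eq_sum_ones, ← Finset.sum_add_distrib]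
        refine Finset.sum_le_sum fun i hi => ?_
        have he : 1 ≤ e i := Nat.one_le_iff_ne_zero.mpr (Finset.mem_filter.mp hi).2
        have := (complexity_pow_le (g i).eval (e i)).trans (Nat.add_le_add_right (ih i) _)
        omega
      refine h1.trans ?_
      calc ∑ i ∈ T, (2 * (g i).size + 2 * e i)
          ≤ ∑ i : Fin k, (2 * (g i).size + 2 * e i) :=
            Finset.sum_le_sum_of_subset_of_nonneg (Finset.filter_subset _ _) fun _ _ _ => Nat.zero_le _
        _ = 2 * ∑ i : Fin k, ((g i).size + e i) := by
          rw [Finset.mul_sum]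
          exact Finset.sum_congr rfl fun i _ => by ring

/-- `deg φ.eval ≤ φ.size ^ φ.depth` (crude: each level multiplies the degree by at most the total edge
weight). [cite: SahaThankey2021, Def. 3 (p. 50:3)] -/
theorem totalDegree_eval_le_size_pow_depth (φ : Formula F n) :
    φ.eval.totalDegree ≤ φ.size ^ φ.depth := by
  classical
  induction φ with
  | leaf p =>
      simp only [Formula.eval, Formula.size, Formula.depth]
      by_cases hp : p = 0
      · simp [hp]
      · have hc : 1 ≤ p.support.card := Finset.card_pos.mpr (support_nonempty.mpr hp)
        calc p.totalDegree ≤ p.support.card * (p.totalDegree + 1) := by nlinarith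
          _ ≤ (p.support.card * (p.totalDegree + 1)) ^ 2 := Nat.le_self_pow two_ne_zero _
  | add k α g ih =>
      simp only [Formula.eval, Formula.size, Formula.depth]
      refine (totalDegree_finsetSum _ _).trans (Finset.sup_le fun i _ => ?_)
      refine (totalDegree_smul_le _ _).trans ((ih i).trans ?_)
      have hmem : (g i).size + 1 ≤ ∑ j : Fin k, ((g j).size + 1) :=
        Finset.single_le_sum (f := fun j : Fin k => (g j).size + 1) (fun j _ => Nat.zero_le _)
          (Finset.mem_univ i)
      have hS : (g i).size ≤ ∑ j : Fin k, ((g j).size + 1) := (Nat.le_add_right _ 1).trans hmem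
      have hS1 : 1 ≤ ∑ j : Fin k, ((g j).size + 1) := (Nat.le_add_left 1 _).trans hmem
      have hΔ : (g i).depth ≤ (Finset.univ.sup fun j : Fin k => (g j).depth) + 1 :=
        (Finset.le_sup (f := fun j : Fin k => (g j).depth) (Finset.mem_univ i)).trans (Nat.le_succ _)
      exact (Nat.pow_le_pow_left hS _).trans (Nat.pow_le_pow_right hS1 hΔ)
  | mulPow k e g ih =>
      simp only [Formula.eval, Formula.size, Formula.depth]
      set S := ∑ j : Fin k, ((g j).size + e j) with hS
      set Δ := (Finset.univ.sup fun j : Fin k => (g j).depth) + 1 with hΔ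
      refine (totalDegree_finsetProd _ _).trans ?_
      have h1 : ∀ i : Fin k, ((g i).eval ^ e i).totalDegree ≤ e i * S ^ (Δ - 1) := by
        intro i
        refine (totalDegree_pow _ _).trans (Nat.mul_le_mul_left _ ((ih i).trans ?_))
        have hmem : (g i).size + e i ≤ S :=
          Finset.single_le_sum (f := fun j : Fin k => (g j).size + e j) (fun j _ => Nat.zero_le _)
            (Finset.mem_univ i)
        have hsz : (g i).size ≤ S := (Nat.le_add_right _ (e i)).trans hmem
        have hdp : (g i).depth ≤ Δ - 1 := by
          have h' : (g i).depth ≤ Finset.univ.sup fun j : Fin k => (g j).depth :=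
            Finset.le_sup (f := fun j : Fin k => (g j).depth) (Finset.mem_univ i)
          omega
        rcases Nat.eq_zero_or_pos S with hS0 | hSpos
        · have : (g i).size = 0 := by omega
          rw [this, hS0, zero_pow (by have := one_le_depth (g i); omega)]
          exact Nat.zero_le _
        · exact (Nat.pow_le_pow_left hsz _).trans (Nat.pow_le_pow_right hSpos hdp)
      calc ∑ i : Fin k, ((g i).eval ^ e i).totalDegree ≤ ∑ i : Fin k, e i * S ^ (Δ - 1) :=
            Finset.sum_le_sum fun i _ => h1 i
        _ = (∑ i : Fin k, e i) * S ^ (Δ - 1) := by rw [Finset.sum_mul]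
        _ ≤ S * S ^ (Δ - 1) := Nat.mul_le_mul_right _
            (Finset.sum_le_sum fun i _ => Nat.le_add_left (e i) ((g i).size))
        _ = S ^ Δ := by
            rw [← pow_succ', Nat.sub_add_cancel (Nat.le_add_left 1 _)]

end AllFormulas

/-! ### Occur-once formulas: the semantic complexity bound (no size hypothesis) -/

section OccurOnce

/-- The occurrence bound is inherited by the children of a `+` gate. [cite: SahaThankey2021, Def. 3 (p. 50:3)] -/
theorem isOccur_of_add {K k : ℕ} {α : Fin k → F} {g : Fin k → Formula F n}
    (h : (Formula.add k α g).IsOccur K) (j : Fin k) : (g j).IsOccur K := fun i =>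
  (Finset.single_le_sum (f := fun j' : Fin k => (g j').occur i) (fun _ _ => Nat.zero_le _)
    (Finset.mem_univ j)).trans (h i)

/-- The occurrence bound is inherited by the children of a `×⋏` gate. [cite: SahaThankey2021, Def. 3 (p. 50:3)] -/
theorem isOccur_of_mulPow {K k : ℕ} {e : Fin k → ℕ} {g : Fin k → Formula F n}
    (h : (Formula.mulPow k e g).IsOccur K) (j : Fin k) : (g j).IsOccur K := fun i =>
  (Finset.single_le_sum (f := fun j' : Fin k => (g j').occur i) (fun _ _ => Nat.zero_le _)
    (Finset.mem_univ j)).trans (h i)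

/-- A variable of the polynomial computed by `φ` occurs in some leaf of `φ`.
[cite: SahaThankey2021, Def. 3 (p. 50:3)] -/
theorem occur_ne_zero_of_mem_vars (φ : Formula F n) {i : Fin n} (hi : i ∈ φ.eval.vars) :
    φ.occur i ≠ 0 := by
  classical
  induction φ with
  | leaf p =>
      simp only [Formula.eval] at hi
      simp only [Formula.occur, if_neg (mem_vars_iff_degreeOf_ne_zero.mp hi)]
      exact one_ne_zero
  | add k α g ih =>
      simp only [Formula.eval] at hi
      obtain ⟨j, -, hj⟩ := Finset.mem_biUnion.mp (vars_sum_subset _ _ hi)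
      rw [smul_eq_C_mul] at hj
      have hj' : i ∈ (g j).eval.vars := by
        have := vars_mul _ _ hj
        rwa [vars_C, Finset.empty_union] at this
      have h1 := Nat.pos_of_ne_zero (ih j hj')
      have h2 : (g j).occur i ≤ (Formula.add k α g).occur i :=
        Finset.single_le_sum (f := fun j' : Fin k => (g j').occur i) (fun _ _ => Nat.zero_le _)
          (Finset.mem_univ j)
      omega
  | mulPow k e g ih =>
      simp only [Formula.eval] at hi
      obtain ⟨j, -, hj⟩ := Finset.mem_biUnion.mp (vars_prod _ hi)
      have h1 := Nat.pos_of_ne_zero (ih j (vars_pow _ _ hj))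
      have h2 : (g j).occur i ≤ (Formula.mulPow k e g).occur i :=
        Finset.single_le_sum (f := fun j' : Fin k => (g j').occur i) (fun _ _ => Nat.zero_le _)
          (Finset.mem_univ j)
      omega

/-- **Occur-once ⇒ siblings have disjoint variables**: if `Σ_j occur_i(g_j) ≤ 1` for every variable
`x_i`, then a variable of the polynomial of `g_j` is not a variable of the polynomial of `g_{j'}`,
`j' ≠ j`. [cite: SahaThankey2021, Def. 3 (p. 50:3)] -/
theorem notMem_vars_of_sum_occur_le_one {k : ℕ} (g : Fin k → Formula F n)
    (hocc : ∀ i, ∑ j, (g j).occur i ≤ 1) {j j' : Fin k} (hjj' : j ≠ j') {i : Fin n}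
    (hi : i ∈ (g j).eval.vars) : i ∉ (g j').eval.vars := by
  classical
  intro hi'
  have h1 := Nat.pos_of_ne_zero (occur_ne_zero_of_mem_vars _ hi)
  have h2 := Nat.pos_of_ne_zero (occur_ne_zero_of_mem_vars _ hi')
  have h3 : (g j).occur i + (g j').occur i ≤ ∑ j'', (g j'').occur i := by
    rw [← Finset.sum_pair (f := fun j'' => (g j'').occur i) hjj']
    exact Finset.sum_le_sum_of_subset_of_nonneg (Finset.subset_univ _) fun _ _ _ => Nat.zero_le _
  have := hocc i
  omega

/-- A non-constant leaf contributes at least `1` to `Σ_i occur_i`. [cite: SahaThankey2021, Def. 3 (p. 50:3)] -/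
theorem one_le_sum_occur_leaf {p : MvPolynomial (Fin n) F} (hp : 0 < p.totalDegree) :
    1 ≤ ∑ i, (Formula.leaf p : Formula F n).occur i := by
  classical
  have hp0 : p ≠ 0 := by
    rintro rfl
    rw [totalDegree_zero] at hp
    exact lt_irrefl 0 hp
  obtain ⟨m, hm, hmax⟩ := Finset.exists_mem_eq_sup p.support (support_nonempty.mpr hp0)
    (fun s => s.sum fun _ e => e)
  have hm0 : m ≠ 0 := by
    intro h0
    rw [totalDegree, hmax, h0, Finsupp.sum_zero_index] at hp
    exact lt_irrefl 0 hp
  obtain ⟨i, hi⟩ : ∃ i, i ∈ m.support := by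
    by_contra h
    push Not at h
    exact hm0 (Finsupp.support_eq_empty.mp (Finset.eq_empty_of_forall_notMem h))
  have hiv : i ∈ p.vars := (mem_vars_iff_mem_support i).mpr ⟨m, hm, hi⟩
  have hocc : (Formula.leaf p : Formula F n).occur i = 1 := by
    simp only [Formula.occur, if_neg (mem_vars_iff_degreeOf_ne_zero.mp hiv)]
  calc 1 = (Formula.leaf p : Formula F n).occur i := hocc.symm
    _ ≤ ∑ i', (Formula.leaf p : Formula F n).occur i' :=
      Finset.single_le_sum (f := fun i' => (Formula.leaf p : Formula F n).occur i')
        (fun _ _ => Nat.zero_le _) (Finset.mem_univ i)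

/-- `Σ_i occur_i` is additive over the children of a `+` gate. [cite: SahaThankey2021, Def. 3 (p. 50:3)] -/
theorem sum_occur_add {k : ℕ} (α : Fin k → F) (g : Fin k → Formula F n) :
    ∑ i, (Formula.add k α g).occur i = ∑ j, ∑ i, (g j).occur i := by
  simp only [Formula.occur]
  exact Finset.sum_comm

/-- `Σ_i occur_i` is additive over the children of a `×⋏` gate. [cite: SahaThankey2021, Def. 3 (p. 50:3)] -/
theorem sum_occur_mulPow {k : ℕ} (e : Fin k → ℕ) (g : Fin k → Formula F n) :
    ∑ i, (Formula.mulPow k e g).occur i = ∑ j, ∑ i, (g j).occur i := by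
  simp only [Formula.occur]
  exact Finset.sum_comm

/-- **No cancellation across disjoint variable sets**: if the `q_j`, `j ∈ N`, have pairwise disjoint
variables, `c_{j₀} ≠ 0` and `q_{j₀}` is non-constant, then `deg q_{j₀} ≤ deg (Σ_j c_j q_j + b)`.
[cite: SahaThankey2021, §1.3 (occur-once formulas: distinct leaves are variable disjoint)] -/
theorem totalDegree_le_of_disjoint_vars {ι : Type*} (N : Finset ι) (c : ι → F)
    (q : ι → MvPolynomial (Fin n) F) (b : F)
    (hdisj : ∀ j ∈ N, ∀ j' ∈ N, j ≠ j' → ∀ i ∈ (q j).vars, i ∉ (q j').vars)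
    {j₀ : ι} (hj₀ : j₀ ∈ N) (hc : c j₀ ≠ 0) (hq : 0 < (q j₀).totalDegree) :
    (q j₀).totalDegree ≤ (∑ j ∈ N, c j • q j + C b).totalDegree := by
  classical
  have hq0 : q j₀ ≠ 0 := by
    intro h0
    rw [h0, totalDegree_zero] at hq
    exact lt_irrefl 0 hq
  obtain ⟨m, hm, hmax⟩ := Finset.exists_mem_eq_sup (q j₀).support (support_nonempty.mpr hq0)
    (fun s => s.sum fun _ e => e)
  have hm0 : m ≠ 0 := by
    intro h0
    rw [totalDegree, hmax, h0, Finsupp.sum_zero_index] at hq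
    exact lt_irrefl 0 hq
  obtain ⟨i, hi⟩ : ∃ i, i ∈ m.support := by
    by_contra h
    push Not at h
    exact hm0 (Finsupp.support_eq_empty.mp (Finset.eq_empty_of_forall_notMem h))
  have hiv : i ∈ (q j₀).vars := (mem_vars_iff_mem_support i).mpr ⟨m, hm, hi⟩
  -- the coefficient of `m` in the sum is `c_{j₀} · coeff m q_{j₀}`
  have hcoeff : coeff m (∑ j ∈ N, c j • q j + C b) = c j₀ * coeff m (q j₀) := by
    rw [coeff_add, coeff_sum, coeff_C, if_neg (Ne.symm hm0), add_zero, Finset.sum_eq_single j₀]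
    · rw [coeff_smul, smul_eq_mul]
    · intro j hj hjj
      rw [coeff_smul, smul_eq_mul]
      have hnot : m ∉ (q j).support := fun hmj =>
        hdisj j₀ hj₀ j hj (Ne.symm hjj) i hiv ((mem_vars_iff_mem_support i).mpr ⟨m, hmj, hi⟩)
      rw [notMem_support_iff.mp hnot, mul_zero]
    · exact fun h => absurd hj₀ h
  have hmem : m ∈ (∑ j ∈ N, c j • q j + C b).support := by
    rw [mem_support_iff, hcoeff]
    exact mul_ne_zero hc (mem_support_iff.mp hm)
  calc (q j₀).totalDegree = m.sum fun _ e => e := hmax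
    _ ≤ _ := le_totalDegree hmem

/-- `deg (a q + b) = deg q` for `a ≠ 0`. [folklore] -/
private theorem totalDegree_smul_add_C {a : F} (ha : a ≠ 0) (q : MvPolynomial (Fin n) F) (b : F) :
    (a • q + C b).totalDegree = q.totalDegree := by
  refine le_antisymm ((totalDegree_add _ _).trans (max_le (totalDegree_smul_le _ _) ?_)) ?_
  · rw [totalDegree_C]
    exact Nat.zero_le _
  · have h : q = a⁻¹ • (a • q + C b) + C (-(a⁻¹ * b)) := by
      rw [smul_add, smul_smul, inv_mul_cancel₀ ha, one_smul, smul_eq_C_mul, ← map_mul, add_assoc,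
        ← map_add, add_neg_cancel, map_zero, add_zero]
    conv_lhs => rw [h]
    refine (totalDegree_add _ _).trans (max_le (totalDegree_smul_le _ _) ?_)
    rw [totalDegree_C]
    exact Nat.zero_le _

/-- `vars q ⊆ vars (a q + b)` for `a ≠ 0`. [folklore] -/
private theorem vars_subset_vars_smul_add_C {a : F} (ha : a ≠ 0) (q : MvPolynomial (Fin n) F) (b : F) :
    q.vars ⊆ (a • q + C b).vars := by
  classical
  have h : q = C a⁻¹ * (a • q + C b) + C (-(a⁻¹ * b)) := by
    rw [← smul_eq_C_mul, smul_add, smul_smul, inv_mul_cancel₀ ha, one_smul, smul_eq_C_mul,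
      ← map_mul, add_assoc, ← map_add, add_neg_cancel, map_zero, add_zero]
  intro i hi
  rw [h] at hi
  rcases Finset.mem_union.mp (vars_add_subset _ _ hi) with h1 | h1
  · have := vars_mul _ _ h1
    rwa [vars_C, Finset.empty_union] at this
  · rw [vars_C] at h1
    exact absurd h1 (Finset.notMem_empty _)

/-- `deg (r^e) = e · deg r` for `r ≠ 0` (integral domain). [folklore] -/
private theorem totalDegree_pow_of_ne_zero {r : MvPolynomial (Fin n) F} (hr : r ≠ 0) (e : ℕ) :
    (r ^ e).totalDegree = e * r.totalDegree := by
  induction e with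
  | zero => simp
  | succ e ih => rw [pow_succ, totalDegree_mul_of_isDomain (pow_ne_zero e hr) hr, ih]; ring

/-- `L(a q + b) ≤ L(q) + 2`. [cite: Burgisser2000, §2.1] -/
theorem complexity_smul_add_C_le (a : F) (q : MvPolynomial (Fin n) F) (b : F) :
    complexity (a • q + C b) ≤ complexity q + 2 := by
  refine (complexity_add_le_holds _ _).trans ?_
  rw [complexity_C_holds (k := F) b, add_zero]
  have := complexity_smul_le_holds (σ := Fin n) a q
  omega

/-- **The semantic core of an occur-once formula (ST Thm. 10's class, no size bound).** For an
occur-once formula `φ` whose leaves of degree `≤ D` cost `≤ w` (`good` is any leaf predicate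
inherited by children, e.g. `LeavesSparse s` or `LeavesVariate b`), the computed polynomial is a
constant, or `φ.eval = a·q + b` with `a ≠ 0`, `q` non-constant, `Σ_i occur_i(φ) ≥ 1`, and — if
`deg q ≤ D` — `L(q) + 2(D+3) ≤ (w + (D+3)(2 + log₂ deg q)) · Σ_i occur_i(φ)`. Induction on `φ`:
constant-valued children are folded into `b`; a gate with one live child is free (`+`, or `×⋏` with
exponent `1`) or a power step `e ≥ 2` doubling the degree (paid by the `log₂` term); a gate with
`≥ 2` live children is paid by the additivity of `Σ_i occur_i`; degrees never drop because siblings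
have disjoint variables (`totalDegree_le_of_disjoint_vars`), so every live `q` below has degree
`≤ deg q ≤ D` and all live exponents are `≤ D`.
[cite: SahaThankey2021, Thm. 10 (p. 50:5) (the class: occur-once formulas with sparse leaves)] -/
theorem exists_core_of_isOccur_one (D w : ℕ) (good : Formula F n → Prop)
    (hleaf : ∀ p, good (Formula.leaf p) → p.totalDegree ≤ D → complexity p ≤ w)
    (hadd : ∀ k α g, good (Formula.add k α g) → ∀ j, good (g j))
    (hmul : ∀ k e g, good (Formula.mulPow k e g) → ∀ j, good (g j)) (φ : Formula F n)
    (hocc : φ.IsOccur 1) (hg : good φ) :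
    (∃ c, φ.eval = C c) ∨
      ∃ (a b : F) (q : MvPolynomial (Fin n) F), a ≠ 0 ∧ φ.eval = a • q + C b ∧
        0 < q.totalDegree ∧ 1 ≤ ∑ i, φ.occur i ∧
        (q.totalDegree ≤ D → complexity q + 2 * (D + 3) ≤
          (w + (D + 3) * (2 + Nat.log 2 q.totalDegree)) * ∑ i, φ.occur i) := by
  classical
  induction φ with
  | leaf p =>
      by_cases hp : p.totalDegree = 0
      · exact Or.inl ⟨coeff 0 p, totalDegree_eq_zero_iff_eq_C.mp hp⟩
      · have hpos := Nat.pos_of_ne_zero hp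
        have hone := one_le_sum_occur_leaf (F := F) hpos
        refine Or.inr ⟨1, 0, p, one_ne_zero, by simp [Formula.eval], hpos, hone, fun hD => ?_⟩
        have hw := hleaf p hg hD
        calc complexity p + 2 * (D + 3) ≤ (w + (D + 3) * (2 + Nat.log 2 p.totalDegree)) * 1 := by
              nlinarith [Nat.zero_le ((D + 3) * Nat.log 2 p.totalDegree)]
          _ ≤ _ := Nat.mul_le_mul_left _ hone
  | add k α g ih =>
      have hoccj : ∀ j, (g j).IsOccur 1 := isOccur_of_add hocc
      have hgj : ∀ j, good (g j) := hadd k α g hg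
      set N : Finset (Fin k) := Finset.univ.filter fun j => α j ≠ 0 ∧ ∀ c, (g j).eval ≠ C c with hN
      have hlive : ∀ j ∈ N, ∃ (a b : F) (q : MvPolynomial (Fin n) F), a ≠ 0 ∧
          (g j).eval = a • q + C b ∧ 0 < q.totalDegree ∧ 1 ≤ ∑ i, (g j).occur i ∧
          (q.totalDegree ≤ D → complexity q + 2 * (D + 3) ≤
            (w + (D + 3) * (2 + Nat.log 2 q.totalDegree)) * ∑ i, (g j).occur i) := by
        intro j hj
        rcases ih j (hoccj j) (hgj j) with ⟨c, hc⟩ | h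
        · exact absurd hc ((Finset.mem_filter.mp hj).2.2 c)
        · exact h
      choose! a b q ha hq hdeg hone hbd using hlive
      have hdead : ∀ j, j ∉ N → ∃ d : F, α j • (g j).eval = C d := by
        intro j hj
        by_cases hα : α j = 0
        · exact ⟨0, by rw [hα, zero_smul, C_0]⟩
        · have : ¬ ∀ c, (g j).eval ≠ C c := fun h =>
            hj (Finset.mem_filter.mpr ⟨Finset.mem_univ _, hα, h⟩)
          push Not at this
          obtain ⟨c, hc⟩ := this
          exact ⟨α j * c, by rw [hc, smul_eq_C_mul, ← map_mul]⟩
      choose! d hd using hdead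
      have hval : (Formula.add k α g).eval =
          ∑ j ∈ N, (α j * a j) • q j + C (∑ j ∈ N, α j * b j + ∑ j ∈ Nᶜ, d j) := by
        have h1 : ∀ j ∈ N, α j • (g j).eval = (α j * a j) • q j + C (α j * b j) := fun j hj => by
          rw [hq j hj, smul_add, smul_smul, smul_eq_C_mul (C (b j)), ← map_mul]
        have h2 : ∀ j ∈ Nᶜ, α j • (g j).eval = C (d j) := fun j hj => hd j (Finset.mem_compl.mp hj)
        simp only [Formula.eval]
        rw [← Finset.sum_add_sum_compl N, Finset.sum_congr rfl h1, Finset.sum_congr rfl h2,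
          Finset.sum_add_distrib, map_add, map_sum, map_sum, add_assoc]
      have hℓj : ∀ j, ∑ i, (g j).occur i ≤ ∑ i, (Formula.add k α g).occur i := fun j => by
        rw [sum_occur_add]
        exact Finset.single_le_sum (f := fun j' => ∑ i, (g j').occur i) (fun _ _ => Nat.zero_le _)
          (Finset.mem_univ j)
      obtain hN0 | hN1 | hN2 : N.card = 0 ∨ N.card = 1 ∨ 2 ≤ N.card := by omega
      · -- no live child: constant
        refine Or.inl ⟨∑ j ∈ N, α j * b j + ∑ j ∈ Nᶜ, d j, ?_⟩
        rw [hval, Finset.card_eq_zero.mp hN0, Finset.sum_empty, zero_add]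
      · -- exactly one live child: same core, affine reparametrisation (free)
        obtain ⟨j₀, hj₀⟩ := Finset.card_eq_one.mp hN1
        have hj₀N : j₀ ∈ N := by rw [hj₀]; exact Finset.mem_singleton_self _
        have hα : α j₀ ≠ 0 := (Finset.mem_filter.mp hj₀N).2.1
        refine Or.inr ⟨α j₀ * a j₀, ∑ j ∈ N, α j * b j + ∑ j ∈ Nᶜ, d j, q j₀,
          mul_ne_zero hα (ha j₀ hj₀N), ?_, hdeg j₀ hj₀N,
          (hone j₀ hj₀N).trans (hℓj j₀), fun hD => (hbd j₀ hj₀N hD).trans (Nat.mul_le_mul_left _ (hℓj j₀))⟩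
        rw [hval, hj₀, Finset.sum_singleton]
      · -- at least two live children: new core, paid by the additivity of `Σ occur`
        set Q : MvPolynomial (Fin n) F := ∑ j ∈ N, (α j * a j) • q j with hQ
        have hdisj : ∀ j ∈ N, ∀ j' ∈ N, j ≠ j' → ∀ i ∈ (q j).vars, i ∉ (q j').vars := by
          intro j hj j' hj' hjj' i hi hi'
          have h1 : i ∈ (g j).eval.vars := by
            rw [hq j hj]; exact vars_subset_vars_smul_add_C (ha j hj) _ _ hi
          have h2 : i ∈ (g j').eval.vars := by
            rw [hq j' hj']; exact vars_subset_vars_smul_add_C (ha j' hj') _ _ hi'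
          exact notMem_vars_of_sum_occur_le_one g (fun i => by simpa [Formula.occur] using hocc i)
            hjj' h1 h2
        have hdegj : ∀ j ∈ N, (q j).totalDegree ≤ Q.totalDegree := fun j hj => by
          have h := totalDegree_le_of_disjoint_vars N (fun j => α j * a j) q 0 hdisj hj
            (mul_ne_zero (Finset.mem_filter.mp hj).2.1 (ha j hj)) (hdeg j hj)
          rwa [C_0, add_zero] at h
        obtain ⟨j₁, hj₁⟩ : N.Nonempty := Finset.card_pos.mp (by omega)
        refine Or.inr ⟨1, _, Q, one_ne_zero, by rw [hval, one_smul], (hdeg j₁ hj₁).trans_le (hdegj j₁ hj₁),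
          (hone j₁ hj₁).trans (hℓj j₁), fun hD => ?_⟩
        set M := w + (D + 3) * (2 + Nat.log 2 Q.totalDegree) with hM
        have hbdj : ∀ j ∈ N, complexity (q j) + 2 * (D + 3) ≤ M * ∑ i, (g j).occur i := fun j hj =>
          (hbd j hj ((hdegj j hj).trans hD)).trans (Nat.mul_le_mul_right _
            (Nat.add_le_add_left (Nat.mul_le_mul_left _
              (Nat.add_le_add_left (Nat.log_mono_right (hdegj j hj)) _)) _))
        have hsum := Finset.sum_le_sum hbdj
        rw [Finset.sum_add_distrib, Finset.sum_const, smul_eq_mul, ← Finset.mul_sum] at hsum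
        have hℓ : ∑ j ∈ N, ∑ i, (g j).occur i ≤ ∑ i, (Formula.add k α g).occur i := by
          rw [sum_occur_add]
          exact Finset.sum_le_sum_of_subset_of_nonneg (Finset.subset_univ N) fun _ _ _ => Nat.zero_le _
        have hMℓ := Nat.mul_le_mul_left M hℓ
        have hLQ : complexity Q ≤ ∑ j ∈ N, complexity (q j) + 2 * N.card := by
          refine (complexity_finset_sum_le N _).trans ?_
          have h1 : ∑ j ∈ N, complexity ((α j * a j) • q j) ≤ ∑ j ∈ N, (complexity (q j) + 1) :=
            Finset.sum_le_sum fun j _ => complexity_smul_le_holds _ _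
          rw [Finset.sum_add_distrib, Finset.sum_const, smul_eq_mul, mul_one] at h1
          omega
        have hkey : 2 * N.card + 2 * (D + 3) ≤ N.card * (2 * (D + 3)) := by nlinarith
        generalize N.card = cN at hsum hLQ hkey
        generalize ∑ j ∈ N, complexity (q j) = SL at hsum hLQ
        generalize ∑ j ∈ N, ∑ i, (g j).occur i = ℓN at hsum hMℓ
        generalize cN * (2 * (D + 3)) = P at hsum hkey
        generalize M * ℓN = R at hsum hMℓ
        omega
  | mulPow k e g ih =>
      have hoccj : ∀ j, (g j).IsOccur 1 := isOccur_of_mulPow hocc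
      have hgj : ∀ j, good (g j) := hmul k e g hg
      set N : Finset (Fin k) := Finset.univ.filter fun j => e j ≠ 0 ∧ ∀ c, (g j).eval ≠ C c with hN
      have hlive : ∀ j ∈ N, ∃ (a b : F) (q : MvPolynomial (Fin n) F), a ≠ 0 ∧
          (g j).eval = a • q + C b ∧ 0 < q.totalDegree ∧ 1 ≤ ∑ i, (g j).occur i ∧
          (q.totalDegree ≤ D → complexity q + 2 * (D + 3) ≤
            (w + (D + 3) * (2 + Nat.log 2 q.totalDegree)) * ∑ i, (g j).occur i) := by
        intro j hj
        rcases ih j (hoccj j) (hgj j) with ⟨c, hc⟩ | h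
        · exact absurd hc ((Finset.mem_filter.mp hj).2.2 c)
        · exact h
      choose! a b q ha hq hdeg hone hbd using hlive
      have hdead : ∀ j, j ∉ N → ∃ d : F, (g j).eval ^ e j = C d := by
        intro j hj
        by_cases he : e j = 0
        · exact ⟨1, by rw [he, pow_zero, C_1]⟩
        · have : ¬ ∀ c, (g j).eval ≠ C c := fun h =>
            hj (Finset.mem_filter.mpr ⟨Finset.mem_univ _, he, h⟩)
          push Not at this
          obtain ⟨c, hc⟩ := this
          exact ⟨c ^ e j, by rw [hc, map_pow]⟩
      choose! d hd using hdead
      set Q : MvPolynomial (Fin n) F := ∏ j ∈ N, (g j).eval ^ e j with hQ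
      set γ : F := ∏ j ∈ Nᶜ, d j with hγ
      have hval : (Formula.mulPow k e g).eval = γ • Q + C 0 := by
        have h2 : ∀ j ∈ Nᶜ, (g j).eval ^ e j = C (d j) := fun j hj => hd j (Finset.mem_compl.mp hj)
        simp only [Formula.eval]
        rw [← Finset.prod_mul_prod_compl N, Finset.prod_congr rfl h2, ← map_prod, C_0, add_zero,
          mul_comm, ← smul_eq_C_mul]
      have hℓj : ∀ j, ∑ i, (g j).occur i ≤ ∑ i, (Formula.mulPow k e g).occur i := fun j => by
        rw [sum_occur_mulPow]
        exact Finset.single_le_sum (f := fun j' => ∑ i, (g j').occur i) (fun _ _ => Nat.zero_le _)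
          (Finset.mem_univ j)
      have hne : ∀ j ∈ N, (g j).eval ≠ 0 := fun j hj h0 =>
        (Finset.mem_filter.mp hj).2.2 0 (by rw [h0, C_0])
      have hQ0 : Q ≠ 0 := Finset.prod_ne_zero_iff.mpr fun j hj => pow_ne_zero _ (hne j hj)
      have hdegr : ∀ j ∈ N, ((g j).eval).totalDegree = (q j).totalDegree := fun j hj => by
        rw [hq j hj, totalDegree_smul_add_C (ha j hj)]
      have hdegQj : ∀ j ∈ N, e j * (q j).totalDegree ≤ Q.totalDegree := fun j hj => by
        rw [← hdegr j hj, ← totalDegree_pow_of_ne_zero (hne j hj)]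
        exact totalDegree_le_of_dvd_of_isDomain (Finset.dvd_prod_of_mem _ hj) hQ0
      have hej : ∀ j ∈ N, 1 ≤ e j := fun j hj => Nat.one_le_iff_ne_zero.mpr (Finset.mem_filter.mp hj).2.1
      by_cases hγ0 : γ = 0
      · exact Or.inl ⟨0, by rw [hval, hγ0, zero_smul, zero_add]⟩
      obtain hN0 | hN1 | hN2 : N.card = 0 ∨ N.card = 1 ∨ 2 ≤ N.card := by omega
      · refine Or.inl ⟨γ, ?_⟩
        rw [hval, hQ, Finset.card_eq_zero.mp hN0, Finset.prod_empty, C_0, add_zero, smul_eq_C_mul,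
          mul_one]
      · obtain ⟨j₀, hj₀⟩ := Finset.card_eq_one.mp hN1
        have hj₀N : j₀ ∈ N := by rw [hj₀]; exact Finset.mem_singleton_self _
        have hQ1 : Q = (g j₀).eval ^ e j₀ := by rw [hQ, hj₀, Finset.prod_singleton]
        by_cases he1 : e j₀ = 1
        · -- one live factor with exponent one: same core (free)
          refine Or.inr ⟨γ * a j₀, γ * b j₀, q j₀, mul_ne_zero hγ0 (ha j₀ hj₀N), ?_, hdeg j₀ hj₀N,
            (hone j₀ hj₀N).trans (hℓj j₀),
            fun hD => (hbd j₀ hj₀N hD).trans (Nat.mul_le_mul_left _ (hℓj j₀))⟩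
          rw [hval, hQ1, he1, pow_one, hq j₀ hj₀N, smul_add, smul_smul, C_0, add_zero,
            smul_eq_C_mul (C (b j₀)), ← map_mul]
        · -- one live factor with exponent ≥ 2: the degree at least doubles
          have he2 : 2 ≤ e j₀ := by have := hej j₀ hj₀N; omega
          have hdq := hdeg j₀ hj₀N
          have hdegQ : Q.totalDegree = e j₀ * (q j₀).totalDegree := by
            rw [hQ1, totalDegree_pow_of_ne_zero (hne j₀ hj₀N), hdegr j₀ hj₀N]
          refine Or.inr ⟨γ, 0, Q, hγ0, hval, by rw [hdegQ]; positivity, (hone j₀ hj₀N).trans (hℓj j₀),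
            fun hD => ?_⟩
          have hqD : (q j₀).totalDegree ≤ D := by nlinarith
          have heD : e j₀ ≤ D := by nlinarith
          have hlog : Nat.log 2 (q j₀).totalDegree + 1 ≤ Nat.log 2 Q.totalDegree := by
            rw [← Nat.log_mul_base one_lt_two (by omega)]
            exact Nat.log_mono_right (by rw [hdegQ]; nlinarith)
          have hb := hbd j₀ hj₀N hqD
          have hLQ : complexity Q ≤ complexity (q j₀) + 2 + e j₀ := by
            rw [hQ1]
            refine (complexity_pow_le _ _).trans (Nat.add_le_add_right ?_ _)
            rw [hq j₀ hj₀N]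
            exact complexity_smul_add_C_le _ _ _
          have hℓ := hℓj j₀
          have hℓ1 := hone j₀ hj₀N
          -- `(w + (D+3)(2 + log q)) ℓ₀ + (D+3) ℓ ≤ (w + (D+3)(2 + log Q)) ℓ`
          have hmono : (w + (D + 3) * (2 + Nat.log 2 (q j₀).totalDegree)) *
                ∑ i, (g j₀).occur i + (D + 3) * ∑ i, (Formula.mulPow k e g).occur i ≤
              (w + (D + 3) * (2 + Nat.log 2 Q.totalDegree)) * ∑ i, (Formula.mulPow k e g).occur i := by
            have h1 : (w + (D + 3) * (2 + Nat.log 2 (q j₀).totalDegree)) * ∑ i, (g j₀).occur i ≤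
                (w + (D + 3) * (2 + Nat.log 2 (q j₀).totalDegree)) *
                  ∑ i, (Formula.mulPow k e g).occur i := Nat.mul_le_mul_left _ hℓ
            have h2 : (w + (D + 3) * (2 + Nat.log 2 (q j₀).totalDegree)) + (D + 3) ≤
                w + (D + 3) * (2 + Nat.log 2 Q.totalDegree) := by nlinarith
            calc _ ≤ (w + (D + 3) * (2 + Nat.log 2 (q j₀).totalDegree)) *
                    ∑ i, (Formula.mulPow k e g).occur i +
                  (D + 3) * ∑ i, (Formula.mulPow k e g).occur i := Nat.add_le_add_right h1 _
              _ = ((w + (D + 3) * (2 + Nat.log 2 (q j₀).totalDegree)) + (D + 3)) *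
                    ∑ i, (Formula.mulPow k e g).occur i := by ring
              _ ≤ _ := Nat.mul_le_mul_right _ h2
          have h3 : D + 3 ≤ (D + 3) * ∑ i, (Formula.mulPow k e g).occur i :=
            Nat.le_mul_of_pos_right _ (by omega)
          generalize (w + (D + 3) * (2 + Nat.log 2 (q j₀).totalDegree)) * ∑ i, (g j₀).occur i = A
            at hb hmono
          generalize (D + 3) * ∑ i, (Formula.mulPow k e g).occur i = B at hmono h3
          generalize (w + (D + 3) * (2 + Nat.log 2 Q.totalDegree)) *
            ∑ i, (Formula.mulPow k e g).occur i = R at hmono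
          omega
      · -- at least two live factors
        have hdegj : ∀ j ∈ N, (q j).totalDegree ≤ Q.totalDegree := fun j hj =>
          le_trans (by have := hej j hj; nlinarith) (hdegQj j hj)
        obtain ⟨j₁, hj₁⟩ : N.Nonempty := Finset.card_pos.mp (by omega)
        refine Or.inr ⟨γ, 0, Q, hγ0, hval, (hdeg j₁ hj₁).trans_le (hdegj j₁ hj₁),
          (hone j₁ hj₁).trans (hℓj j₁), fun hD => ?_⟩
        set M := w + (D + 3) * (2 + Nat.log 2 Q.totalDegree) with hM
        have hbdj : ∀ j ∈ N, complexity (q j) + 2 * (D + 3) ≤ M * ∑ i, (g j).occur i := fun j hj =>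
          (hbd j hj ((hdegj j hj).trans hD)).trans (Nat.mul_le_mul_right _
            (Nat.add_le_add_left (Nat.mul_le_mul_left _
              (Nat.add_le_add_left (Nat.log_mono_right (hdegj j hj)) _)) _))
        have hsum := Finset.sum_le_sum hbdj
        rw [Finset.sum_add_distrib, Finset.sum_const, smul_eq_mul, ← Finset.mul_sum] at hsum
        have hℓ : ∑ j ∈ N, ∑ i, (g j).occur i ≤ ∑ i, (Formula.mulPow k e g).occur i := by
          rw [sum_occur_mulPow]
          exact Finset.sum_le_sum_of_subset_of_nonneg (Finset.subset_univ N) fun _ _ _ => Nat.zero_le _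
        have hMℓ := Nat.mul_le_mul_left M hℓ
        have heD : ∀ j ∈ N, e j ≤ D := fun j hj => by
          have h1 := hdegQj j hj
          have h2 := hdeg j hj
          nlinarith
        have hLQ : complexity Q ≤ ∑ j ∈ N, complexity (q j) + N.card * (D + 3) := by
          refine (complexity_finset_prod_le N _).trans ?_
          have h1 : ∑ j ∈ N, complexity ((g j).eval ^ e j) ≤ ∑ j ∈ N, (complexity (q j) + (D + 2)) := by
            refine Finset.sum_le_sum fun j hj => (complexity_pow_le _ _).trans ?_
            have := complexity_smul_add_C_le (a j) (q j) (b j)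
            rw [← hq j hj] at this
            have := heD j hj
            omega
          rw [Finset.sum_add_distrib, Finset.sum_const, smul_eq_mul] at h1
          have : N.card * (D + 2) + N.card = N.card * (D + 3) := by ring
          omega
        have hkey : N.card * (D + 3) + 2 * (D + 3) ≤ N.card * (2 * (D + 3)) := by nlinarith
        generalize N.card = cN at hsum hLQ hkey
        generalize ∑ j ∈ N, complexity (q j) = SL at hsum hLQ
        generalize ∑ j ∈ N, ∑ i, (g j).occur i = ℓN at hsum hMℓ
        generalize cN * (2 * (D + 3)) = P at hsum hkey
        generalize cN * (D + 3) = P' at hLQ hkey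
        generalize M * ℓN = R at hsum hMℓ
        omega

/-- **`L(φ.eval) ≤ (w + (D+3)(2 + log₂ D)) · n`** for an occur-once formula `φ` with `deg φ.eval ≤ D`
whose degree-`≤ D` leaves cost `≤ w`. [cite: SahaThankey2021, Thm. 10 (p. 50:5) (the class)] -/
theorem complexity_eval_le_of_isOccur_one (D w : ℕ) (good : Formula F n → Prop)
    (hleaf : ∀ p, good (Formula.leaf p) → p.totalDegree ≤ D → complexity p ≤ w)
    (hadd : ∀ k α g, good (Formula.add k α g) → ∀ j, good (g j))
    (hmul : ∀ k e g, good (Formula.mulPow k e g) → ∀ j, good (g j)) (φ : Formula F n)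
    (hocc : φ.IsOccur 1) (hg : good φ) (hD : φ.eval.totalDegree ≤ D) :
    complexity φ.eval ≤ (w + (D + 3) * (2 + Nat.log 2 D)) * n := by
  rcases exists_core_of_isOccur_one D w good hleaf hadd hmul φ hocc hg with
    ⟨c, hc⟩ | ⟨a, b, q, ha, hq, -, -, hbd⟩
  · rw [hc, complexity_C_holds]
    exact Nat.zero_le _
  · have hqD : q.totalDegree ≤ D := by rwa [hq, totalDegree_smul_add_C ha] at hD
    have h1 := hbd hqD
    have hℓ : ∑ i, φ.occur i ≤ n :=
      (Finset.sum_le_sum fun i _ => hocc i).trans (by simp)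
    have hM : (w + (D + 3) * (2 + Nat.log 2 q.totalDegree)) * ∑ i, φ.occur i ≤
        (w + (D + 3) * (2 + Nat.log 2 D)) * n :=
      Nat.mul_le_mul (Nat.add_le_add_left (Nat.mul_le_mul_left _
        (Nat.add_le_add_left (Nat.log_mono_right hqD) _)) _) hℓ
    have hL : complexity φ.eval ≤ complexity q + 2 := by
      rw [hq]
      exact complexity_smul_add_C_le _ _ _
    omega

/-- **Occur-once formulas with `s`-sparse leaves (ST Thm. 10's class)**: `deg φ.eval ≤ D ⇒
L(φ.eval) ≤ (2s(D+1) + (D+3)(2 + log₂ D)) · n`. [cite: SahaThankey2021, Thm. 10 (p. 50:5)] -/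
theorem complexity_eval_le_of_isOccur_one_of_leavesSparse {s D : ℕ} (φ : Formula F n)
    (hocc : φ.IsOccur 1) (hs : φ.LeavesSparse s) (hD : φ.eval.totalDegree ≤ D) :
    complexity φ.eval ≤ (2 * s * (D + 1) + (D + 3) * (2 + Nat.log 2 D)) * n := by
  refine complexity_eval_le_of_isOccur_one D (2 * s * (D + 1)) (Formula.LeavesSparse s)
    (fun p hp hpD => (complexity_le_card_support_mul p).trans ?_)
    (fun k α g h j => h j) (fun k e g h j => h j) φ hocc hs hD
  have hp' : p.support.card ≤ s := hp
  calc p.support.card * (2 * p.totalDegree + 2) ≤ s * (2 * D + 2) := Nat.mul_le_mul hp' (by omega)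
    _ = 2 * s * (D + 1) := by ring

/-- **Occur-once formulas with `b`-variate leaves (ST Thm. 10, second clause)**: `deg φ.eval ≤ D ⇒
L(φ.eval) ≤ (2(D+1)^{b+1} + (D+3)(2 + log₂ D)) · n`. [cite: SahaThankey2021, Thm. 10 (p. 50:5)] -/
theorem complexity_eval_le_of_isOccur_one_of_leavesVariate {b D : ℕ} (φ : Formula F n)
    (hocc : φ.IsOccur 1) (hb : φ.LeavesVariate b) (hD : φ.eval.totalDegree ≤ D) :
    complexity φ.eval ≤ (2 * (D + 1) ^ (b + 1) + (D + 3) * (2 + Nat.log 2 D)) * n := by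
  refine complexity_eval_le_of_isOccur_one D (2 * (D + 1) ^ (b + 1)) (Formula.LeavesVariate b)
    (fun p hp hpD => (complexity_le_card_support_mul p).trans ?_)
    (fun k α g h j => h j) (fun k e g h j => h j) φ hocc hb hD
  have hp' : p.vars.card ≤ b := hp
  have hc : p.support.card ≤ (D + 1) ^ b :=
    (card_support_le_pow_card_vars p).trans
      ((Nat.pow_le_pow_left (by omega) _).trans (Nat.pow_le_pow_right (by omega) hp'))
  calc p.support.card * (2 * p.totalDegree + 2) ≤ (D + 1) ^ b * (2 * (D + 1)) :=
        Nat.mul_le_mul hc (by omega)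
    _ = 2 * (D + 1) ^ (b + 1) := by ring

end OccurOnce

end SahaThankey2021

end Literature.Computability.AlgebraicComplexity

end
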